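import Literature.NumberTheory.IwasawaTheory.ClassicalMuVanishesSplitCartanFiveImage
import Literature.NumberTheory.IwasawaTheory.ClassicalMuVanishesDivisionFieldThree
import HarnessLib

set_option autoImplicit false

/-!
# `μ = 0` for `ℚ(E[5])_cyc` (the hypothesis of the class-group road to Coates–Sujatha (A) at `p = 5`) for elliptic curves with
# split-Cartan-normaliser mod-5 image, from `μ = 0` of four explicit subfields — modulo Ferrero–Washington alone

Topic `NumberTheory/IwasawaTheory` (namespace = path).  THEOREM-ONLY file (no definition, no named fact, no `sorry`); literature seat
`bsd-potss-conjA-anchor` g11 (supports stmt-BirchSwinnertonDyer-19413: KT rows with split Cartan image at `5`; closes nothing).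
The `ℚ(E[5])`-level form of `ClassicalMuVanishesSplitCartanFiveImage`: the representation is the tree's own
`exists_matrixRep_divisionField` in a basis `e` of `E[5]` in which `Γ_ℚ` acts through `splitCartanNormalizer 5` (the body of
`HasSplitCartanNormalizerModPImage E 5` with the basis exposed, because the three Frobenius-type elements `σ_u, σ_v, σ_w ∈ Γ_ℚ` are
specified by their matrices `diag(2,1)`, `diag(1,2)`, `(0 1; 1 0)` in THAT basis).  Inputs: «`μ = 0` for every cyclotomic
`ℤ_5`-extension» of the fixed fields in `ℚ(E[5])` of `⟨σ̄_v⟩` (`= ℚ(P₁)`, `P₁ = e⁻¹(1,0)`, degree 8), `⟨σ̄_u² σ̄_v⟩` (degree 8),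
`⟨σ̄_u²⟩ ⊔ ⟨σ̄_v⟩` (`= ℚ(x P₁)`, degree 4), `⟨σ̄_u σ̄_v⟩ ⊔ ⟨σ̄_w⟩` (`= ℚ(⟨P₁ + P₂⟩)`, degree 4), where `σ̄ = σ|_{ℚ(E[5])}`
(`absRestrictNormalHom`); output: «`μ = 0` for every cyclotomic `ℤ_5`-extension of `ℚ(E[5])`» — verbatim the hypothesis of
`CoatesSujatha2005.thm34_fineSelmerDual_moduleFinite_of_classicalMuVanishes_divisionField` at `p = 5`.

References: [Serre1972, §2.2, §4.1]; [Lemmermeyer1994, §1]; [Washington1997, §7.5, §13.1]; [SilvermanAEC2009, III.§7].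
-/

noncomputable section

open scoped NumberField Matrix

open Field IntermediateField WeierstrassCurve Literature.NumberTheory.EllipticCurves Literature.NumberTheory.GaloisRepresentations
  Literature.NumberTheory.SerreUniformity

namespace Literature.NumberTheory.IwasawaTheory

/-- `Γ_ℚ → Gal(ℚ(E[n])/ℚ)` is onto. [folklore] -/
private theorem absRestrictNormalHom_surjective_dF₅ {F : Type*} [Field F] (E : IntermediateField F (AlgebraicClosure F))
    [Normal F E] : Function.Surjective (absRestrictNormalHom E) := fun g => by
  obtain ⟨σ, hσ⟩ := AlgEquiv.restrictNormalHom_surjective (AlgebraicClosure F) g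
  exact ⟨(absoluteGaloisGroup.toAlgEquiv F).symm σ, hσ⟩

/-- Two matrices with the same action on the vectors `e P` are equal. [folklore] -/
private theorem matrix_eq_of_forall_mulVec₅ {A : Type*} [AddCommGroup A] {n : ℕ} (e : A ≃+ (Fin 2 → ZMod n))
    {M N : Matrix (Fin 2) (Fin 2) (ZMod n)} (h : ∀ P : A, M *ᵥ e P = N *ᵥ e P) : M = N :=
  Matrix.toLin'.injective (LinearMap.ext fun v => by
    rw [Matrix.toLin'_apply, Matrix.toLin'_apply, ← e.apply_symm_apply v, h])

/-- `…_splitCartanNormalizer_five_fixedField` for any `ℚ`-algebra structure on `L` (all coincide: `Subsingleton (Algebra ℚ L)`).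
[cite: Serre1972, §2.2 (split Cartan subgroups, normalisers)] [cite: Washington1997, §7.5, §13.1] -/
private theorem split_five_fixedField_alg (hFW : ferreroWashington1979_classicalMuVanishes) [Fact (Nat.Prime 5)]
    (L : Type) [Field L] [NumberField L] [alg : Algebra ℚ L] [IsGalois ℚ L]
    (ρ : (L ≃ₐ[ℚ] L) →* Matrix (Fin 2) (Fin 2) (ZMod 5)) (hρ : Function.Injective ρ)
    (himg : ∀ g, ρ g ∈ splitCartanNormalizer 5) {u v w : L ≃ₐ[ℚ] L} (hu : ρ u = !![2, 0; 0, 1])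
    (hv : ρ v = !![1, 0; 0, 2]) (hw : ρ w = !![0, 1; 1, 0])
    (hμP : ∀ κE : ZpExtension ↥(fixedField (Subgroup.zpowers v)) 5, κE.IsCyclotomic → ClassicalMuVanishes κE)
    (hμD : ∀ κE : ZpExtension ↥(fixedField (Subgroup.zpowers (u * u * v))) 5, κE.IsCyclotomic → ClassicalMuVanishes κE)
    (hμX : ∀ κE : ZpExtension ↥(fixedField (Subgroup.zpowers (u * u) ⊔ Subgroup.zpowers v)) 5,
      κE.IsCyclotomic → ClassicalMuVanishes κE)
    (hμC : ∀ κE : ZpExtension ↥(fixedField (Subgroup.zpowers (u * v) ⊔ Subgroup.zpowers w)) 5,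
      κE.IsCyclotomic → ClassicalMuVanishes κE)
    (κL : ZpExtension L 5) (hκL : κL.IsCyclotomic) : ClassicalMuVanishes κL := by
  have h : alg = DivisionRing.toRatAlgebra := Subsingleton.elim _ _
  subst h
  exact classicalMuVanishes_of_isCyclotomic_of_splitCartanNormalizer_five_fixedField hFW L ρ hρ himg hu hv hw hμP hμD hμX hμC κL
    hκL

/-- **`μ = 0` for `ℚ(E[5])_cyc` from a split-Cartan-normaliser mod-5 image, modulo Ferrero–Washington alone.**  `E/ℚ` elliptic;
`e` a basis of `E[5]` in which every `σ ∈ Γ_ℚ` acts through `splitCartanNormalizer 5` (so `HasSplitCartanNormalizerModPImage E 5`);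
`σ_u, σ_v, σ_w ∈ Γ_ℚ` acting in the basis `e` as `diag(2,1)`, `diag(1,2)`, `(0 1; 1 0)` (they exist when the image is all of
`C_s⁺(5)`).  If `μ = 0` holds for every cyclotomic `ℤ_5`-extension of the fixed fields in `ℚ(E[5])` of `⟨σ̄_v⟩` (`= ℚ(P₁)`),
`⟨σ̄_u² σ̄_v⟩`, `⟨σ̄_u²⟩ ⊔ ⟨σ̄_v⟩` (`= ℚ(x P₁)`) and `⟨σ̄_u σ̄_v⟩ ⊔ ⟨σ̄_w⟩` (`= ℚ(⟨P₁+P₂⟩)`), then for every cyclotomic `ℤ_5`-extension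
of `ℚ(E[5])`: the hypothesis of road (b) (`CoatesSujatha2005.thm34_…`) at `p = 5`.  No growth theorem; five Kuroda equalities.
[cite: Serre1972, §2.2 (split Cartan subgroups, normalisers)] [cite: Lemmermeyer1994, §1 (Kuroda's class number formula, odd part)]
[cite: Washington1997, §7.5, §13.1] -/
theorem classicalMuVanishes_divisionField_of_splitCartanBasis_five (hFW : ferreroWashington1979_classicalMuVanishes)
    [Fact (Nat.Prime 5)] (W : WeierstrassCurve ℚ) [W.IsElliptic] (e : W.geomTorsion (5 : ℕ) ≃+ (Fin 2 → ZMod 5))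
    (he : ∀ σ : absoluteGaloisGroup ℚ, ∃ M ∈ splitCartanNormalizer 5, ∀ P : W.geomTorsion (5 : ℕ), e (σ • P) = M *ᵥ e P)
    (σu σv σw : absoluteGaloisGroup ℚ) (hσu : ∀ P : W.geomTorsion (5 : ℕ), e (σu • P) = !![2, 0; 0, 1] *ᵥ e P)
    (hσv : ∀ P : W.geomTorsion (5 : ℕ), e (σv • P) = !![1, 0; 0, 2] *ᵥ e P)
    (hσw : ∀ P : W.geomTorsion (5 : ℕ), e (σw • P) = !![0, 1; 1, 0] *ᵥ e P)
    (hμP : haveI : NumberField ↥(W.divisionField 5) := NumberField.mk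
      ∀ κE : ZpExtension ↥(fixedField (Subgroup.zpowers (absRestrictNormalHom (W.divisionField 5) σv))) 5,
        κE.IsCyclotomic → ClassicalMuVanishes κE)
    (hμD : haveI : NumberField ↥(W.divisionField 5) := NumberField.mk
      ∀ κE : ZpExtension ↥(fixedField (Subgroup.zpowers (absRestrictNormalHom (W.divisionField 5) σu *
        absRestrictNormalHom (W.divisionField 5) σu * absRestrictNormalHom (W.divisionField 5) σv))) 5,
        κE.IsCyclotomic → ClassicalMuVanishes κE)
    (hμX : haveI : NumberField ↥(W.divisionField 5) := NumberField.mk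
      ∀ κE : ZpExtension ↥(fixedField (Subgroup.zpowers (absRestrictNormalHom (W.divisionField 5) σu *
        absRestrictNormalHom (W.divisionField 5) σu) ⊔ Subgroup.zpowers (absRestrictNormalHom (W.divisionField 5) σv))) 5,
        κE.IsCyclotomic → ClassicalMuVanishes κE)
    (hμC : haveI : NumberField ↥(W.divisionField 5) := NumberField.mk
      ∀ κE : ZpExtension ↥(fixedField (Subgroup.zpowers (absRestrictNormalHom (W.divisionField 5) σu *
        absRestrictNormalHom (W.divisionField 5) σv) ⊔ Subgroup.zpowers (absRestrictNormalHom (W.divisionField 5) σw))) 5,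
        κE.IsCyclotomic → ClassicalMuVanishes κE) :
    haveI : NumberField ↥(W.divisionField 5) := NumberField.mk
    ∀ κL : ZpExtension ↥(W.divisionField 5) 5, κL.IsCyclotomic → ClassicalMuVanishes κL := by
  haveI : NumberField ↥(W.divisionField 5) := NumberField.mk
  intro κL hκL
  obtain ⟨ρ, hρ, hρe⟩ := exists_matrixRep_divisionField W 5 e
  have hπ := absRestrictNormalHom_surjective_dF₅ (W.divisionField 5)
  have hmat : ∀ (σ : absoluteGaloisGroup ℚ) (M : Matrix (Fin 2) (Fin 2) (ZMod 5)),
      (∀ P : W.geomTorsion (5 : ℕ), e (σ • P) = M *ᵥ e P) → ρ (absRestrictNormalHom (W.divisionField 5) σ) = M :=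
    fun σ M hM => matrix_eq_of_forall_mulVec₅ e fun P => by rw [← hρe, hM]
  have himg' : ∀ g, ρ g ∈ splitCartanNormalizer 5 := fun g => by
    obtain ⟨σ, rfl⟩ := hπ g
    obtain ⟨M, hM, hMe⟩ := he σ
    rw [hmat σ M hMe]
    exact hM
  exact @split_five_fixedField_alg hFW _ ↥(W.divisionField 5) _ _ (_) (W.isGalois_divisionField 5) ρ hρ himg' _ _ _
    (hmat σu _ hσu) (hmat σv _ hσv) (hmat σw _ hσw) hμP hμD hμX hμC κL hκL

end Literature.NumberTheory.IwasawaTheory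

end
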